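import Mathlib
import Summits.RiemannHypothesis.RiemannHypothesis.Theorems.WeilFarFloorCoshSplitRH
import Summits.RiemannHypothesis.RiemannHypothesis.Theorems.WeilFarFloorCoshTest
import Summits.RiemannHypothesis.RiemannHypothesis.Theorems.WeilFarFloorWindowSmoothing
import Summits.RiemannHypothesis.RiemannHypothesis.Theorems.WeilFarFloorShiftFormLipschitz
import HarnessLib

/-!
# The mollified cosh profile and its perturbation bounds

Helper file (`--supports stmt-RiemannHypothesis-0098`, lead-track anchor: Weil-positivity window ladder, format-C far bound),
pure proofs, RH-free.  Seat rh-explicit-weil-1 gen12 (memo `run/shared/lean/pub/rh-explicit/rh-explicit-weil-1/FORMAT-K3.md` §13.7):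
toolkit for stage 3 of C-XIII″ («under RH the cosh test is asymptotically THE extremal»).

`C_b = cosh(·/2)·1_{[−b,b]}` is the cosh profile of the window (`∫C_b² = b + sinh b`, file `WeilFarFloorCoshTest`).  Stage 3 splits a
Weil test `u` on `[−b', b']` as `u = c·C_m + r` along a SMOOTH profile `C_m` (so that `r` is again a Weil test and the RH anatomy applies
to it); this file provides `C_m` and the elementary perturbation bounds:

* `exists_smoothProfile` : for `ε > 0` a real Weil test `C_m` (the bump average of `C_b`, `WeilFarFloorWindowSmoothing`) supported in
  `[−(b+ε), b+ε]`, admissible with `|C_m| ≤ cosh(b/2)`, `∫C_m² ≤ ∫C_b²`, increments `D_t(C_m) ≤ D_t(C_b)` for all `t`, and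
  `∫(C_m − C_b)² ≤ δ` whenever `∫(C_b(x−y) − C_b(x))² ≤ δ` for `|y| ≤ ε` (the cosh profile's `L²`-modulus, `WeilFarFloorCoshProfileEnergy`);
* `integral_sq_coshProfile_sub_coshProfile_le` : `∫(C_{b'} − C_b)² ≤ 2(b' − b)·cosh²(b'/2)` for `b ≤ b'` (nested windows);
* `abs_integral_sq_sub_le` : `|∫f² − ∫g²| ≤ ‖f − g‖₂(‖f‖₂ + ‖g‖₂)`;  `integral_sq_ge_of_near` : `∫g² ≥ ∫f² − 2‖f‖₂‖f − g‖₂` when `∫g² ≤ ∫f²`;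
* `abs_primeShiftQuotient_sub_le` : `|Q_B(f)/∫f² − Q_B(g)/∫g²| ≤ 2W_B·‖f − g‖₂(‖f‖₂ + ‖g‖₂)/∫f²` when `0 < ∫g² ≤ ∫f²`
  (`W_B = Σ_{log n<2B} 2Λ(n)/√n`): the Rayleigh quotient of the prime-shift form moves little from `C_b` to `C_m`.
Standard axioms only.
-/

set_option linter.dupNamespace false
set_option autoImplicit false

noncomputable section

open MeasureTheory Set Filter
open scoped Real Topology ArithmeticFunction.vonMangoldt

namespace Summit.RiemannHypothesis.RiemannHypothesis.Theorems.WeilFormatC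

namespace FloorCoshSplit

open Literature.NumberTheory.LFunctions

variable {b b' B ε : ℝ} {f g : ℝ → ℝ} {Cf Cg : ℝ}

/-! ## §1 The mollified profile -/

/-- **The mollified cosh profile.**  For `ε > 0` there is a real Weil test `C_m` supported in `[−(b+ε), b+ε]`, admissible with
`|C_m| ≤ cosh(b/2)`, with `∫C_m² ≤ ∫C_b²`, contracted increments `∫(C_m(x+t) − C_m(x))² ≤ ∫(C_b(x+t) − C_b(x))²`, and
`∫(C_m − C_b)² ≤ δ` for every `δ` bounding the `L²`-modulus of `C_b` at scale `ε`. -/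
theorem exists_smoothProfile (b : ℝ) (hε : 0 < ε) :
    ∃ Cm : ℝ → ℝ, IsWeilTest (fun x ↦ (Cm x : ℂ)) ∧ tsupport (fun x ↦ (Cm x : ℂ)) ⊆ Icc (-(b + ε)) (b + ε) ∧
      Measurable Cm ∧ (∀ x, |Cm x| ≤ Real.cosh (b / 2)) ∧ (∀ x, x ∉ Icc (-(b + ε)) (b + ε) → Cm x = 0) ∧
      (∫ x, Cm x ^ 2 ≤ ∫ x, (Icc (-b) b).indicator (fun y ↦ Real.cosh (y / 2)) x ^ 2) ∧
      (∀ t, ∫ x, (Cm (x + t) - Cm x) ^ 2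
        ≤ ∫ x, ((Icc (-b) b).indicator (fun y ↦ Real.cosh (y / 2)) (x + t)
            - (Icc (-b) b).indicator (fun y ↦ Real.cosh (y / 2)) x) ^ 2) ∧
      (∀ δ : ℝ, (∀ y ∈ Icc (-ε) ε, ∫ x, ((Icc (-b) b).indicator (fun y ↦ Real.cosh (y / 2)) (x - y)
            - (Icc (-b) b).indicator (fun y ↦ Real.cosh (y / 2)) x) ^ 2 ≤ δ) →
        ∫ x, (Cm x - (Icc (-b) b).indicator (fun y ↦ Real.cosh (y / 2)) x) ^ 2 ≤ δ) := by
  set C : ℝ → ℝ := (Icc (-b) b).indicator (fun y ↦ Real.cosh (y / 2)) with hCdef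
  obtain ⟨hCm, hCb, hCs⟩ := FloorCosh.coshTest_admissible b
  obtain ⟨hψm, hψ0, hψC, hψs, hψ1⟩ := FloorSmoothing.bump_weight hε
  set ψ : ℝ → ℝ := fun y ↦ (⟨ε / 2, ε, by positivity, by linarith⟩ : ContDiffBump (0 : ℝ)).normed volume y with hψdef
  set Cm : ℝ → ℝ := fun x ↦ ∫ y, ψ y * C (x - y) with hCmdef
  obtain ⟨hCmm, hCmb, hCms⟩ : Measurable Cm ∧ (∀ x, |Cm x| ≤ Real.cosh (b / 2)) ∧
      (∀ x, x ∉ Icc (-(b + ε)) (b + ε) → Cm x = 0) :=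
    FloorSmoothing.smoothed_admissible hCm hCb hCs hψm hψ0 hψs hψ1
  refine ⟨Cm, FloorSmoothing.isWeilTest_smoothed hε hCm hCb hCs, FloorSmoothing.tsupport_smoothed_subset hε hCm hCb hCs,
    hCmm, hCmb, hCms, FloorSmoothing.integral_smoothed_sq_le hCm hCb hCs hψm hψ0 hψC hψs hψ1,
    fun t ↦ ?_, fun δ hδ ↦ FloorSmoothing.integral_sq_smoothed_sub_le hCm hCb hCs hψm hψ0 hψC hψs hψ1 hδ⟩
  simpa only [hCmdef, hCdef] using FloorSmoothing.integral_sq_smoothed_sub_smoothed_le hCm hCb hCs hψm hψ0 hψC hψs hψ1 t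

/-! ## §2 Perturbation bounds -/

/-- **Nested windows**: `∫(C_{b'} − C_b)² ≤ 2(b' − b)·cosh²(b'/2)` for `b ≤ b'`. -/
theorem integral_sq_coshProfile_sub_coshProfile_le (hbb : b ≤ b') :
    ∫ x, ((Icc (-b') b').indicator (fun y ↦ Real.cosh (y / 2)) x - (Icc (-b) b).indicator (fun y ↦ Real.cosh (y / 2)) x) ^ 2
      ≤ 2 * (b' - b) * Real.cosh (b' / 2) ^ 2 := by
  set S : Set ℝ := Icc (-b') b' \ Icc (-b) b with hS
  have hSm : MeasurableSet S := measurableSet_Icc.diff measurableSet_Icc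
  -- pointwise: the difference lives on the collar and is bounded by `cosh(b'/2)` there
  have hpt : ∀ x, ((Icc (-b') b').indicator (fun y ↦ Real.cosh (y / 2)) x
      - (Icc (-b) b).indicator (fun y ↦ Real.cosh (y / 2)) x) ^ 2 ≤ S.indicator (fun _ ↦ Real.cosh (b' / 2) ^ 2) x := by
    intro x
    by_cases hx : x ∈ Icc (-b) b
    · have hx' : x ∈ Icc (-b') b' := ⟨by linarith [hx.1], by linarith [hx.2]⟩
      rw [indicator_of_mem hx', indicator_of_mem hx, sub_self, indicator_of_notMem (fun h ↦ h.2 hx)]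
      norm_num
    · by_cases hx' : x ∈ Icc (-b') b'
      · rw [indicator_of_mem hx', indicator_of_notMem hx, sub_zero, indicator_of_mem (show x ∈ S from ⟨hx', hx⟩)]
        have h1 : |x / 2| ≤ b' / 2 := by rw [abs_div, abs_two]; exact div_le_div_of_nonneg_right (abs_le.2 ⟨hx'.1, hx'.2⟩) two_pos.le
        have h2 : Real.cosh (x / 2) ≤ Real.cosh (b' / 2) := by
          rw [← Real.cosh_abs (x / 2), ← Real.cosh_abs (b' / 2)]
          exact Real.cosh_le_cosh.2 (by rw [abs_abs, abs_abs]; exact h1.trans (le_abs_self _))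
        exact pow_le_pow_left₀ (Real.cosh_pos _).le h2 2
      · rw [indicator_of_notMem hx', indicator_of_notMem hx, sub_zero, indicator_of_notMem (fun h ↦ hx' h.1)]
        norm_num
  have hvol : volume.real S ≤ 2 * (b' - b) := by
    have hsub : S ⊆ Icc (-b') (-b) ∪ Icc b b' := by
      intro x hx
      rcases hx with ⟨hx1, hx2⟩
      by_cases hxl : x ≤ -b
      · exact Or.inl ⟨hx1.1, hxl⟩
      · refine Or.inr ⟨?_, hx1.2⟩
        by_contra hlt
        exact hx2 ⟨by linarith, by linarith⟩
    calc volume.real S ≤ volume.real (Icc (-b') (-b) ∪ Icc b b') :=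
          measureReal_mono hsub (measure_union_lt_top measure_Icc_lt_top measure_Icc_lt_top).ne
      _ ≤ volume.real (Icc (-b') (-b)) + volume.real (Icc b b') := measureReal_union_le _ _
      _ = 2 * (b' - b) := by rw [Real.volume_real_Icc_of_le (by linarith), Real.volume_real_Icc_of_le hbb]; ring
  have hint : Integrable (S.indicator fun _ : ℝ ↦ Real.cosh (b' / 2) ^ 2) :=
    (integrable_indicator_iff hSm).2 (integrableOn_const
      ((measure_mono sdiff_subset).trans_lt measure_Icc_lt_top).ne)
  calc ∫ x, ((Icc (-b') b').indicator (fun y ↦ Real.cosh (y / 2)) x - (Icc (-b) b).indicator (fun y ↦ Real.cosh (y / 2)) x) ^ 2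
      ≤ ∫ x, S.indicator (fun _ ↦ Real.cosh (b' / 2) ^ 2) x :=
        integral_mono_of_nonneg (Eventually.of_forall fun x ↦ sq_nonneg _) hint (Eventually.of_forall hpt)
    _ = Real.cosh (b' / 2) ^ 2 * volume.real S := by rw [integral_indicator hSm, setIntegral_const, smul_eq_mul, mul_comm]
    _ ≤ 2 * (b' - b) * Real.cosh (b' / 2) ^ 2 := by
        rw [mul_comm]; exact mul_le_mul_of_nonneg_right hvol (sq_nonneg _)

/-- **`|∫f² − ∫g²| ≤ ‖f − g‖₂·(‖f‖₂ + ‖g‖₂)`** for admissible `f, g` on `[−B, B]`. -/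
theorem abs_integral_sq_sub_le (hf : Measurable f) (hg : Measurable g) (hCf : ∀ x, |f x| ≤ Cf) (hCg : ∀ x, |g x| ≤ Cg)
    (hfs : ∀ x, x ∉ Icc (-B) B → f x = 0) (hgs : ∀ x, x ∉ Icc (-B) B → g x = 0) :
    |(∫ x, f x ^ 2) - ∫ x, g x ^ 2|
      ≤ Real.sqrt (∫ x, (f x - g x) ^ 2) * (Real.sqrt (∫ x, f x ^ 2) + Real.sqrt (∫ x, g x ^ 2)) := by
  have h := FloorSmoothing.abs_integral_shift_mul_sub_le hf hg hCf hCg hfs hgs 0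
  simp only [sub_zero] at h
  have e1 : ∫ x, f x * f x = ∫ x, f x ^ 2 := integral_congr_ae (Eventually.of_forall fun x ↦ by simp only; ring)
  have e2 : ∫ x, g x * g x = ∫ x, g x ^ 2 := integral_congr_ae (Eventually.of_forall fun x ↦ by simp only; ring)
  rwa [e1, e2] at h

/-- **A nearby function keeps most of the norm**: `∫g² ≥ ∫f² − 2‖f‖₂·‖f − g‖₂` when `∫g² ≤ ∫f²`. -/
theorem integral_sq_ge_of_near (hf : Measurable f) (hg : Measurable g) (hCf : ∀ x, |f x| ≤ Cf) (hCg : ∀ x, |g x| ≤ Cg)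
    (hfs : ∀ x, x ∉ Icc (-B) B → f x = 0) (hgs : ∀ x, x ∉ Icc (-B) B → g x = 0) (hgf : ∫ x, g x ^ 2 ≤ ∫ x, f x ^ 2) :
    (∫ x, f x ^ 2) - 2 * Real.sqrt (∫ x, f x ^ 2) * Real.sqrt (∫ x, (f x - g x) ^ 2) ≤ ∫ x, g x ^ 2 := by
  have h := abs_integral_sq_sub_le hf hg hCf hCg hfs hgs
  have hsg : Real.sqrt (∫ x, g x ^ 2) ≤ Real.sqrt (∫ x, f x ^ 2) := Real.sqrt_le_sqrt hgf
  have hd0 : 0 ≤ Real.sqrt (∫ x, (f x - g x) ^ 2) := Real.sqrt_nonneg _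
  have h' := (le_abs_self _).trans h
  nlinarith [mul_le_mul_of_nonneg_left hsg hd0]

/-- **The Rayleigh quotient of `Q_B` is Lipschitz in the test**: for admissible `f, g` on `[−B, B]` with `0 < ∫g² ≤ ∫f²`,
`|Q_B(f)/∫f² − Q_B(g)/∫g²| ≤ 2W_B·‖f − g‖₂(‖f‖₂ + ‖g‖₂)/∫f²`, `W_B = Σ_{log n<2B} 2Λ(n)/√n`. -/
theorem abs_primeShiftQuotient_sub_le (hf : Measurable f) (hg : Measurable g) (hCf : ∀ x, |f x| ≤ Cf) (hCg : ∀ x, |g x| ≤ Cg)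
    (hfs : ∀ x, x ∉ Icc (-B) B → f x = 0) (hgs : ∀ x, x ∉ Icc (-B) B → g x = 0) (hg0 : 0 < ∫ x, g x ^ 2)
    (hgf : ∫ x, g x ^ 2 ≤ ∫ x, f x ^ 2) :
    |primeShiftForm B f / (∫ x, f x ^ 2) - primeShiftForm B g / (∫ x, g x ^ 2)|
      ≤ 2 * (∑ n ∈ weilPrimeIndex B, 2 * ((Λ n : ℝ) / Real.sqrt n))
          * (Real.sqrt (∫ x, (f x - g x) ^ 2) * (Real.sqrt (∫ x, f x ^ 2) + Real.sqrt (∫ x, g x ^ 2))) / ∫ x, f x ^ 2 := by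
  set F := ∫ x, f x ^ 2 with hF
  set G := ∫ x, g x ^ 2 with hG
  set W := ∑ n ∈ weilPrimeIndex B, 2 * ((Λ n : ℝ) / Real.sqrt n) with hW
  set E := Real.sqrt (∫ x, (f x - g x) ^ 2) * (Real.sqrt F + Real.sqrt G) with hE
  have hF0 : 0 < F := hg0.trans_le hgf
  have hW0 : 0 ≤ W := Finset.sum_nonneg fun n _ ↦
    mul_nonneg (by norm_num) (div_nonneg ArithmeticFunction.vonMangoldt_nonneg (Real.sqrt_nonneg _))
  have hE0 : 0 ≤ E := by positivity
  -- `|Q f − Q g| ≤ W E`, `|Q g| ≤ W G`, `|F − G| ≤ E`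
  have hQ : |primeShiftForm B f - primeShiftForm B g| ≤ W * E := FloorSmoothing.abs_primeShiftForm_sub_le hf hg hCf hCg hfs hgs
  have hQg : |primeShiftForm B g| ≤ W * G := by
    refine abs_le.2 ⟨?_, primeShiftForm_le_weightSum_mul hg hCg hgs⟩
    -- `−Q(g) = Q(g) − 2Q(g) ≥ −W G` from `|Q g − Q 0|`-type bound: use the Lipschitz bound against `0`
    have h0 := FloorSmoothing.abs_primeShiftForm_sub_le hg (measurable_const : Measurable fun _ : ℝ ↦ (0 : ℝ)) hCg
      (fun _ ↦ by simp only [abs_zero]; exact (abs_nonneg _).trans (hCg 0)) hgs (fun _ _ ↦ rfl)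
    have hQ0 : primeShiftForm B (fun _ : ℝ ↦ (0 : ℝ)) = 0 := by simp [primeShiftForm]
    simp only [sub_zero, hQ0] at h0
    rw [show (∫ x, (0 : ℝ) ^ 2) = 0 by simp, Real.sqrt_zero, add_zero, ← hG, Real.mul_self_sqrt hg0.le] at h0
    linarith [(neg_abs_le _).trans (le_refl (primeShiftForm B g)), (abs_le.1 (h0)).1]
  have hFG : |F - G| ≤ E := abs_integral_sq_sub_le hf hg hCf hCg hfs hgs
  -- combine: Q f/F − Q g/G = ((Q f − Q g) G + Q g (G − F))/(F G)
  have e : primeShiftForm B f / F - primeShiftForm B g / G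
      = ((primeShiftForm B f - primeShiftForm B g) * G + primeShiftForm B g * (G - F)) / (F * G) := by
    field_simp; ring
  rw [e, abs_div, abs_of_pos (mul_pos hF0 hg0), div_le_div_iff₀ (mul_pos hF0 hg0) hF0]
  calc |(primeShiftForm B f - primeShiftForm B g) * G + primeShiftForm B g * (G - F)| * F
      ≤ (W * E * G + W * G * E) * F := by
        refine mul_le_mul_of_nonneg_right ((abs_add_le _ _).trans (add_le_add ?_ ?_)) hF0.le
        · rw [abs_mul, abs_of_pos hg0]; exact mul_le_mul_of_nonneg_right hQ hg0.le
        · rw [abs_mul, abs_sub_comm]; exact mul_le_mul hQg hFG (abs_nonneg _) (by positivity)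
    _ = 2 * W * E * (F * G) := by ring

end FloorCoshSplit

end Summit.RiemannHypothesis.RiemannHypothesis.Theorems.WeilFormatC
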